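import Summits.BirchSwinnertonDyer.BirchSwinnertonDyer.Theorems.GoldfeldAllTwistsTwoConverseTwinHeegnerHalvesMinimalTwin
import Summits.BirchSwinnertonDyer.BirchSwinnertonDyer.Theorems.GoldfeldAllTwistsTwoConverseTwinHeegnerHalvesNondegeneracy
import Summits.BirchSwinnertonDyer.BirchSwinnertonDyer.Theorems.GoldfeldAllTwistsTwoConverseTwinHeegnerHalvesParityCore
import Summits.BirchSwinnertonDyer.BirchSwinnertonDyer.Theorems.GoldfeldAllTwistsTwoConverseTwinTorsion
import Summits.BirchSwinnertonDyer.BirchSwinnertonDyer.Theorems.GoldfeldGoodTwistsAllTwistsLeaf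
import Literature.NumberTheory.EllipticCurves.BSDShaProofs
import Literature.NumberTheory.QuadraticFields.KroneckerSplitting
import Literature.NumberTheory.QuadraticFields.FundamentalDiscriminant
import Literature.NumberTheory.EllipticCurves.HeegnerPointsImaginaryQuadraticProofs
import Literature.NumberTheory.EllipticCurves.ModularityVersionApProofs
import Literature.NumberTheory.EllipticCurves.NoEverywhereGoodReductionRat
import HarnessLib

set_option linter.dupNamespace false -- `…BirchSwinnertonDyer.BirchSwinnertonDyer…` is the cell's namespace (D-0017)
set_option autoImplicit false

/-!
# Twin″ (item 19140) — line «heegner-halves» v2: **THE PARITY LAW P1 ON THE CELL** — `ord₂ 𝔮` is EVEN for every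
# admissible Heegner datum of a globally minimal `49a1^{(d)}`, `d ≢ 1 (mod 4)`, `7 ∤ d`, granted the published binders

Leafhand `leafhand-bsd-goldfeldalltwistst-3-g1` (prover, explicit unit, 2026-08-31; director-bsd (719)(3): the keyed
follow-up generation on the PROVABLE sub-target «P1 on the cell» only), `--supports stmt-BirchSwinnertonDyer-19140`
(crux twin″ `BSDTwoCMSevenAdditiveRankOne`, registered skeleton `5ff791a1e67d6e63` = line «heegner-halves» v2).
Theses-free; theorems only; no `sorry`, no definition, no new named fact, no instance, no notation. HONEST FRAMING:
this is the crux MOD 2 on the `j = −3375`, `7 ∤ d` part of the cell, GRANTED the published binders the half-stubs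
already carry (Gross–Zagier, Kolyvagin, GZK, modularity, Burungale–Flach) plus Cassels–Tate; it closes NO stub of the
line (both `2`-adic halves stay research-open; the print bundle stays Literature debt); item 19140 is NOT closed; BSD
is proved for no curve. As the typing seat recorded (`P2/CMRankOneAtTwoHeegnerIndexParity.lean`), P1 is Kramer's
parity theorem in disguise and is NOT evidence for BSD — what is new here is that it is now a THEOREM of the tree on
the cell, so every candidate closer of either half can be checked against it (an odd `ord₂ 𝔮` = a normalisation slip).

STATEMENT (`even_padicValRat_cmHeegnerIndexQuotient_of_cellTwist`, §4). `d` squarefree, `d ≢ 1 (mod 4)`, `7 ∤ d`;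
`W` globally minimal with `C • W = X₀(49)^{(d)}` (the cell's twist currency, seat c301: `j(W) = −3375`, CM, `2` split
in `ℚ(√−7)`, additive at `2`); an admissible Heegner datum `(N, K, Dt, H, ι, P, Wd, Cd, k)` exactly as in the
half-stubs, with the Heegner hypothesis ALSO at the bad primes `2, 7, ℓ ∣ d` (`hHd`; §2: automatic for `N = N_W`, and
for the stubs' level `N` granted Carayol's `IsNewformOf.level_eq_conductorNorm` —
`…_of_conductorNorm`, `…_of_carayol`). Then **`Even (padicValRat 2 (cmHeegnerIndexQuotient W K P Dt.c k Wd Cd.u))`**.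

PROOF. §3 `𝔮 = s²·8/(n·#Ш(Wd)·c(Wd)·|u|·c_W)`, all factors non-zero (`heegnerDatum_nondegenerate_of_facts`, p794051);
§1 `D = d_K < 0`, `D ≡ 1 (mod 8)` squarefree, `(D/7) = 1`, `gcd(d,D) = 1` (decomposition laws of
`QuadraticFields/KroneckerSplitting`, `isFundamentalDiscriminant_discr`), so `d·D` is a cell parameter; then `n = 1`
(`j = −3375`), `|u| = 1` (`abs_u_eq_one_of_twin_minimal`, p800340), `#Ш(Wd)` a square (Cassels–Tate; finite by
Burungale–Flach), `ord₂ c_W = 3 + ι(d) + 2σ(d)`, `ord₂ c(Wd) = 3 + ι(d·D) + 2σ(d·D)` (uniform Tamagawa law p539097 /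
p800340), and `ι(d) + ι(d·D)` ODD (ParityCore p798948): `ord₂ 𝔮 ≡ 3 − 3 − 3 − (ι(d) + ι(d·D)) ≡ 0 (mod 2)`. §2:
`Δ_min(W) = −2¹²·7³·d⁶` for every minimal model of the cell, so `2, 7, ℓ ∣ d` divide `N_W`.
WHAT REMAINS of «P1 on the cell»: (e) the `7 ∣ d` twists (`49a3^{(d′)}`: the Tamagawa law is typed for `7 ∤ d`
only); (d) the `j = 16581375` curves (`49a2`/`49a4` twists: `n = 2`, own Tamagawa law, not in the tree). The line
does not need them (the item reduces to `j = −3375` by Cassels, `bsdTwoCMSevenAdditiveRankOne_iff_j_neg3375`), but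
P1 itself is model-sensitive.

References: [Kramer1981] Thm. 1; [GrossZagier1986] I.6.3, V.§2; [BurungaleFlach2024] Thm. 1.1, Cor. 2; [MilneADT2006]
I.6.13 (Cassels–Tate); [Silverman1994] IV.9 Table 4.1; [SilvermanAEC2009] VII.1.3, VIII.8; [IrelandRosen1990] 13.1.3–4;
[DiamondShurman2005] §8.3, Thm. 8.8.1; [Miller2011LMS] §1.
-/

noncomputable section

open scoped Classical

open WeierstrassCurve NumberField Literature.NumberTheory.EllipticCurves Literature.NumberTheory.QuadraticFields
  Literature.NumberTheory.EllipticCurves.ModularForms Literature.NumberTheory.EllipticCurves.Rank1Residual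
  Literature.NumberTheory.EllipticCurves.Rank1Residual.Typed

namespace Summit.BirchSwinnertonDyer.BirchSwinnertonDyer.Theorems.GoldfeldGoodTwists

open Summit.BirchSwinnertonDyer.Rank1Residual Summit.BirchSwinnertonDyer.Rank1Residual.P2

/-! ## §1 The Heegner discriminant of the cell: `d_K < 0`, `≡ 1 (mod 8)`, squarefree, `(d_K/7) = 1`, prime to `d` -/

section Discriminant

variable {K : Type} [Field K] [NumberField K]

/-- A split odd prime `ℓ` of a quadratic field does not divide `d_K` (`(d_K/ℓ) = 1 ≠ 0`). [folklore] -/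
theorem not_dvd_discr_of_ncard_primesOver_eq_two (h2 : Module.finrank ℚ K = 2) {l : ℕ} (hl : l.Prime)
    (hl2 : l ≠ 2) (hsplit : ((Ideal.span {(l : ℤ)}).primesOver (𝓞 K)).ncard = 2) :
    ¬ (l : ℤ) ∣ NumberField.discr K := by
  haveI := Fact.mk hl
  have hJ := (Quadratic.ncard_primesOver_eq_two_iff_jacobiSym h2 hl hl2).mp hsplit
  rw [← jacobiSym.legendreSym.to_jacobiSym] at hJ
  intro hdvd
  have h0 : legendreSym l (NumberField.discr K) = 0 :=
    (legendreSym.eq_zero_iff l _).mpr ((ZMod.intCast_zmod_eq_zero_iff_dvd _ l).mpr hdvd)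
  rw [h0] at hJ
  exact zero_ne_one hJ

/-- **The arithmetic of an admissible Heegner discriminant on the cell.** Let `K` be imaginary quadratic and suppose
every prime factor of `14·|d|` splits in `K` (the Heegner hypothesis at the bad primes `2`, `7`, `ℓ ∣ d` of a curve of
the cell with parameter `d`; `d` squarefree, `d ≢ 1 (mod 4)`, `7 ∤ d`). Then `D = d_K` satisfies: `D < 0`;
`D ≡ 1 (mod 8)` (`2` split); `D` squarefree (an odd fundamental discriminant); `(D/7) = 1` (`7` split);
`gcd(d, D) = 1` (a split prime does not ramify); hence `d·D` is squarefree, `d·D ≡ d ≢ 1 (mod 4)` and `7 ∤ d·D` —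
the twin `W^{(D)} ≅ 49a1^{(d·D)}` lies in the same cell family. [cite: IrelandRosen1990, Prop. 13.1.3 and 13.1.4]
[cite: Gross1984, §3 (Heegner hypothesis)] -/
theorem heegnerDiscr_arith_of_split (hK : IsImaginaryQuadratic K) {d : ℤ} (hsq : Squarefree d) (hd4 : d % 4 ≠ 1)
    (h7 : ¬ (7 : ℤ) ∣ d) (hHd : SatisfiesHeegnerHypothesis (14 * d.natAbs) K) :
    NumberField.discr K < 0 ∧ NumberField.discr K % 8 = 1 ∧ Squarefree (NumberField.discr K) ∧
      jacobiSym (NumberField.discr K) 7 = 1 ∧ Int.gcd d (NumberField.discr K) = 1 ∧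
      Squarefree (d * NumberField.discr K) ∧ (d * NumberField.discr K) % 4 ≠ 1 ∧
      ¬ (7 : ℤ) ∣ d * NumberField.discr K := by
  have h2 : Module.finrank ℚ K = 2 := hK.1
  have hDneg : NumberField.discr K < 0 := hK.discr_neg
  -- `2` splits: `D ≡ 1 (mod 8)`
  have hs2 := hHd 2 Nat.prime_two (dvd_mul_of_dvd_left (by norm_num) _)
  have hD8 : NumberField.discr K % 8 = 1 := by
    refine (Quadratic.ncard_primesOver_two_eq_two_iff h2).mp ?_
    simpa using hs2
  -- `7` splits: `(D/7) = 1`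
  have hD7 : jacobiSym (NumberField.discr K) 7 = 1 :=
    (Quadratic.ncard_primesOver_eq_two_iff_jacobiSym h2 (by norm_num) (by norm_num)).mp
      (hHd 7 (by norm_num) (dvd_mul_of_dvd_left (by norm_num) _))
  -- `D` squarefree (odd fundamental discriminant)
  have hDsq : Squarefree (NumberField.discr K) := by
    rcases Quadratic.isFundamentalDiscriminant_discr (K := K) h2 with ⟨-, hsqD, -⟩ | ⟨h4, -, -⟩
    · exact hsqD
    · exfalso; omega
  -- `gcd(d, D) = 1`
  have hcopN : Nat.Coprime d.natAbs (NumberField.discr K).natAbs := by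
    refine Nat.coprime_of_dvd fun l hl hld hlD => ?_
    have hlD' : (l : ℤ) ∣ NumberField.discr K := Int.natCast_dvd.mpr hlD
    by_cases hl2 : l = 2
    · subst hl2; omega
    · exact not_dvd_discr_of_ncard_primesOver_eq_two h2 hl hl2
        (hHd l hl (dvd_mul_of_dvd_right hld _)) hlD'
  have hcop : Int.gcd d (NumberField.discr K) = 1 := by rw [Int.gcd_eq_natAbs]; exact hcopN
  -- `d·D` squarefree, `≡ d (mod 4)`, prime to `7`
  have hsqD : Squarefree (d * NumberField.discr K) :=
    squarefree_mul_iff.mpr ⟨(Int.isCoprime_iff_gcd_eq_one.mpr hcop).isRelPrime, hsq, hDsq⟩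
  have hdD4 : (d * NumberField.discr K) % 4 ≠ 1 := by
    rw [Int.mul_emod, show NumberField.discr K % 4 = 1 by omega, mul_one, Int.emod_emod_of_dvd _ (dvd_refl _)]
    exact hd4
  have h7D : ¬ (7 : ℤ) ∣ d * NumberField.discr K := by
    intro h
    rcases Int.Prime.dvd_mul' (p := 7) (by norm_num) h with h' | h'
    · exact h7 (by exact_mod_cast h')
    · haveI : Fact (Nat.Prime 7) := ⟨by norm_num⟩
      have h0 : legendreSym 7 (NumberField.discr K) = 0 :=
        (legendreSym.eq_zero_iff 7 _).mpr ((ZMod.intCast_zmod_eq_zero_iff_dvd _ 7).mpr (by exact_mod_cast h'))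
      rw [jacobiSym.legendreSym.to_jacobiSym] at h0
      rw [h0] at hD7
      exact zero_ne_one hD7
  exact ⟨hDneg, hD8, hDsq, hD7, hcop, hsqD, hdD4, h7D⟩

end Discriminant

/-! ## §2 The bad primes of a curve of the cell split in every Heegner field for its conductor -/

section Conductor

variable {d : ℤ}

/-- **`Δ_min(W) = −2¹²·7³·d⁶` for every globally minimal `W` with `C • W = X₀(49)^{(d)}`** (`d` squarefree,
`d ≢ 1 (mod 4)`): `(½,0,0,0)·C` carries `W` to the globally minimal `X₀(49)^{(4d)}` (`isGloballyMinimal_cellTwist`,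
`minimalDiscriminantInt_cellTwist`) and the minimal discriminant does not depend on the minimal model
(`minimalDiscriminantInt_smul_eq_holds`). [cite: SilvermanAEC2009, VIII.8 (remark after Cor. 8.3)] [cite: Kraus1989, Prop. 2] -/
theorem minimalDiscriminantInt_of_smul_eq_cm7_quadraticTwist (hsq : Squarefree d) (hd4 : d % 4 ≠ 1)
    (W : WeierstrassCurve ℚ) [W.IsElliptic] [W.IsGloballyMinimal] (C : VariableChange ℚ)
    (hC : C • W = cm7.quadraticTwist (d : ℚ)) : minimalDiscriminantInt W = -(2 ^ 12 * 7 ^ 3 * d ^ 6) := by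
  haveI := isGloballyMinimal_cellTwist hsq hd4
  have h4d : ((4 * d : ℤ) : ℚ) = (2 : ℚ) ^ 2 * (d : ℚ) := by push_cast; ring
  have hmin : ((⟨(Units.mk0 (2 : ℚ) two_ne_zero)⁻¹, 0, 0, 0⟩ : VariableChange ℚ) * C) • W =
      cm7.quadraticTwist ((4 * d : ℤ) : ℚ) := by
    rw [mul_smul, hC, h4d, cm7.quadraticTwist_sq_mul two_ne_zero]
  haveI hI : (((⟨(Units.mk0 (2 : ℚ) two_ne_zero)⁻¹, 0, 0, 0⟩ : VariableChange ℚ) * C) • W).IsGloballyMinimal := by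
    rw [hmin]; infer_instance
  have key : ∀ (V : WeierstrassCurve ℚ) [V.IsGloballyMinimal], V = cm7.quadraticTwist ((4 * d : ℤ) : ℚ) →
      minimalDiscriminantInt V = -(2 ^ 12 * 7 ^ 3 * d ^ 6) := by
    intro V _ hV
    subst hV
    exact minimalDiscriminantInt_cellTwist hsq hd4
  rw [← minimalDiscriminantInt_smul_eq_holds W ((⟨(Units.mk0 (2 : ℚ) two_ne_zero)⁻¹, 0, 0, 0⟩ : VariableChange ℚ) * C)]
  exact key _ hmin

/-- **Every prime factor of `14·|d|` is a bad prime of `W`** (`C • W = X₀(49)^{(d)}`, `W` globally minimal, `d`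
squarefree, `d ≢ 1 (mod 4)`): it divides `Δ_min(W) = −2¹²·7³·d⁶`, hence `W` is not good there
(`not_hasGoodReductionAtPrime_of_dvd_minimalDiscriminantInt`) and it divides the conductor
(`dvd_conductorNorm_iff_not_hasGoodReductionAtPrime`). [cite: SilvermanAEC2009, VII.5 Prop. 5.1(a)]
[cite: DiamondShurman2005, §8.3] -/
theorem dvd_conductorNorm_of_dvd_cellLevel (hsq : Squarefree d) (hd4 : d % 4 ≠ 1)
    (W : WeierstrassCurve ℚ) [W.IsElliptic] [W.IsGloballyMinimal] (C : VariableChange ℚ)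
    (hC : C • W = cm7.quadraticTwist (d : ℚ)) {p : ℕ} (hp : p.Prime) (hpd : p ∣ 14 * d.natAbs) :
    p ∣ W.conductorNorm ℤ := by
  haveI := Fact.mk hp
  rw [dvd_conductorNorm_iff_not_hasGoodReductionAtPrime]
  refine not_hasGoodReductionAtPrime_of_dvd_minimalDiscriminantInt W p ?_
  rw [minimalDiscriminantInt_of_smul_eq_cm7_quadraticTwist hsq hd4 W C hC, dvd_neg]
  have h1 : (p : ℤ) ∣ 14 * d := by
    rw [← Int.natAbs_dvd_natAbs]
    simpa [Int.natAbs_mul] using hpd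
  exact h1.trans ⟨2 ^ 11 * 7 ^ 2 * d ^ 5, by ring⟩

/-- **The Heegner hypothesis at the conductor gives it at the cell level `14·|d|`**: every prime factor of `14·|d|`
divides `N_W`, so it splits in any `K` satisfying the Heegner hypothesis for `N_W`.
[cite: Gross1984, §3 (Heegner hypothesis)] [cite: DiamondShurman2005, §8.3] -/
theorem satisfiesHeegnerHypothesis_cellLevel_of_conductorNorm (hsq : Squarefree d) (hd4 : d % 4 ≠ 1)
    (W : WeierstrassCurve ℚ) [W.IsElliptic] [W.IsGloballyMinimal] (C : VariableChange ℚ)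
    (hC : C • W = cm7.quadraticTwist (d : ℚ)) {K : Type} [Field K] [NumberField K]
    (hH : SatisfiesHeegnerHypothesis (W.conductorNorm ℤ) K) : SatisfiesHeegnerHypothesis (14 * d.natAbs) K :=
  fun p hp hpd => hH p hp (dvd_conductorNorm_of_dvd_cellLevel hsq hd4 W C hC hp hpd)

/-- The same from a Heegner hypothesis at ANY level `N` that IS the conductor — e.g. the level of a modular
parametrisation datum, granted Carayol's theorem `IsNewformOf.level_eq_conductorNorm` (a named fact of the tree).
[cite: DiamondShurman2005, Thm. 8.8.1] -/
theorem satisfiesHeegnerHypothesis_cellLevel_of_level_eq (hsq : Squarefree d) (hd4 : d % 4 ≠ 1)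
    (W : WeierstrassCurve ℚ) [W.IsElliptic] [W.IsGloballyMinimal] (C : VariableChange ℚ)
    (hC : C • W = cm7.quadraticTwist (d : ℚ)) {K : Type} [Field K] [NumberField K] {N : ℕ}
    (hN : N = W.conductorNorm ℤ) (hH : SatisfiesHeegnerHypothesis N K) :
    SatisfiesHeegnerHypothesis (14 * d.natAbs) K :=
  satisfiesHeegnerHypothesis_cellLevel_of_conductorNorm hsq hd4 W C hC (hN ▸ hH)

end Conductor

/-! ## §3 The `L`-free index quotient: a square times `8 / (n · #Ш(Wd) · c(Wd) · |u| · c_W)` -/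

section Quotient

/-- The `2`-adic valuation of a non-zero square natural number is even (private copy of the 5-line lemma
`P2.even_padicValNat_two_of_isSquare` of `Rank1Residual/P2/CMRankOneAtTwoHeegnerIndexParity.lean`, whose module is
outside this file's import closure). [folklore] -/
private theorem even_padicValNat_two_of_isSquare' {n : ℕ} (hn : n ≠ 0) (h : IsSquare n) :
    Even (padicValNat 2 n) := by
  obtain ⟨m, rfl⟩ := h
  have hm : m ≠ 0 := by rintro rfl; exact hn (by simp)
  haveI : Fact (2 : ℕ).Prime := ⟨Nat.prime_two⟩
  rw [padicValNat.mul hm hm]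
  exact ⟨_, rfl⟩

/-- **`𝔮 = s² · t`** with `s = I·t_W·#Wd(ℚ) / (k·t_K·c·w)` and `t = 8 / (n·#Ш(Wd)·∏c_ℓ(Wd)·|u|·∏c_p(W))`: the
squared factors of the `L`-free index quotient separated from its units (valid whenever the squared denominators
`k, t_K, c, w, #Wd(ℚ)` are non-zero). [cite: Miller2011LMS, §1] -/
theorem cmHeegnerIndexQuotient_eq_sq_mul (W : WeierstrassCurve ℚ) (K : Type) [Field K] [NumberField K]
    (P : (W.baseChange K).toAffine.Point) (c : ℤ) (k : ℕ) (Wd : WeierstrassCurve ℚ) (u : ℚ)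
    (hk : (k : ℚ) ≠ 0) (htK : ((W.baseChange K).torsionOrder : ℚ) ≠ 0) (hc : (c : ℚ) ≠ 0)
    (hw : (Units.torsionOrder K : ℚ) ≠ 0) (hpts : (Nat.card Wd.toAffine.Point : ℚ) ≠ 0) :
    cmHeegnerIndexQuotient W K P c k Wd u =
      (((AddSubgroup.zmultiples P).index : ℚ) * (W.torsionOrder : ℚ) * (Nat.card Wd.toAffine.Point : ℚ) /
          ((k : ℚ) * ((W.baseChange K).torsionOrder : ℚ) * (c : ℚ) * (Units.torsionOrder K : ℚ))) ^ 2 *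
        (8 / (((W.baseChange ℝ).numRealComponents : ℚ) * (Wd.shaOrder : ℚ) * (Wd.tamagawaProduct : ℚ) * |u| *
          (W.tamagawaProduct : ℚ))) := by
  unfold cmHeegnerIndexQuotient twinQuotient
  field_simp

/-- **`ord₂ 𝔮 ≡ ord₂ t (mod 2)`**: with all factors non-zero, `ord₂ 𝔮 = 2·ord₂ s + ord₂ t`, so `ord₂ 𝔮` is even iff
`ord₂ (8 / (n·#Ш(Wd)·c(Wd)·|u|·c_W))` is. [cite: Miller2011LMS, §1] -/
theorem even_padicValRat_cmHeegnerIndexQuotient_iff (W : WeierstrassCurve ℚ) (K : Type) [Field K] [NumberField K]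
    (P : (W.baseChange K).toAffine.Point) (c : ℤ) (k : ℕ) (Wd : WeierstrassCurve ℚ) (u : ℚ)
    (hI : ((AddSubgroup.zmultiples P).index : ℚ) ≠ 0) (htW : (W.torsionOrder : ℚ) ≠ 0)
    (hk : (k : ℚ) ≠ 0) (htK : ((W.baseChange K).torsionOrder : ℚ) ≠ 0) (hc : (c : ℚ) ≠ 0)
    (hw : (Units.torsionOrder K : ℚ) ≠ 0) (hpts : (Nat.card Wd.toAffine.Point : ℚ) ≠ 0)
    (hn : ((W.baseChange ℝ).numRealComponents : ℚ) ≠ 0) (hsha : (Wd.shaOrder : ℚ) ≠ 0)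
    (hcd : (Wd.tamagawaProduct : ℚ) ≠ 0) (hu : |u| ≠ 0) (hcW : (W.tamagawaProduct : ℚ) ≠ 0) :
    Even (padicValRat 2 (cmHeegnerIndexQuotient W K P c k Wd u)) ↔
      Even (padicValRat 2 (8 / (((W.baseChange ℝ).numRealComponents : ℚ) * (Wd.shaOrder : ℚ) *
        (Wd.tamagawaProduct : ℚ) * |u| * (W.tamagawaProduct : ℚ)))) := by
  haveI : Fact (Nat.Prime 2) := ⟨Nat.prime_two⟩
  rw [cmHeegnerIndexQuotient_eq_sq_mul W K P c k Wd u hk htK hc hw hpts]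
  have hs : ((AddSubgroup.zmultiples P).index : ℚ) * (W.torsionOrder : ℚ) * (Nat.card Wd.toAffine.Point : ℚ) /
      ((k : ℚ) * ((W.baseChange K).torsionOrder : ℚ) * (c : ℚ) * (Units.torsionOrder K : ℚ)) ≠ 0 :=
    div_ne_zero (mul_ne_zero (mul_ne_zero hI htW) hpts) (mul_ne_zero (mul_ne_zero (mul_ne_zero hk htK) hc) hw)
  have ht : (8 : ℚ) / (((W.baseChange ℝ).numRealComponents : ℚ) * (Wd.shaOrder : ℚ) *
      (Wd.tamagawaProduct : ℚ) * |u| * (W.tamagawaProduct : ℚ)) ≠ 0 :=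
    div_ne_zero (by norm_num) (mul_ne_zero (mul_ne_zero (mul_ne_zero (mul_ne_zero hn hsha) hcd) hu) hcW)
  rw [padicValRat.mul (pow_ne_zero _ hs) ht, padicValRat.pow, Nat.cast_ofNat, Int.even_add]
  exact ⟨fun h => h.mp (even_two_mul _), fun h => ⟨fun _ => h, fun _ => even_two_mul _⟩⟩

end Quotient

/-! ## §4 P1 on the cell -/

section ParityLaw

variable {d : ℤ}

/-- **P1 ON THE CELL (twist currency).** `d` squarefree, `d ≢ 1 (mod 4)`, `7 ∤ d`; `W` a globally minimal model of
`49a1^{(d)}` (`C • W = X₀(49)^{(d)}`); `(N, K, Dt, H, ι, P, Wd, Cd, k)` an admissible Heegner datum as in the halves of the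
line, the Heegner hypothesis holding for `N` AND for the bad primes `2, 7, ℓ ∣ d` (`hHd`; automatic when `N = N_W`, §2).
GRANTED Gross–Zagier, Kolyvagin, GZK, modularity, Burungale–Flach (the halves' binders) and Cassels–Tate (`hCT`):
**`ord₂ 𝔮` is EVEN**, `𝔮 = cmHeegnerIndexQuotient W K P Dt.c k Wd Cd.u` — the crux `BSDTwoCMSevenAdditiveRankOne` MOD 2
on this part of the cell (both half-stubs compare `ord₂ 𝔮` with the even `ord₂ #Ш(W)`). Proof in the module docstring.
[cite: Kramer1981, Thm. 1] [cite: GrossZagier1986, Thm. I.6.3 and V.§2] [cite: BurungaleFlach2024, Thm. 1.1 and Cor. 2]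
[cite: Silverman1994, IV.9 Table 4.1] [cite: MilneADT2006, Thm. I.6.13] -/
theorem even_padicValRat_cmHeegnerIndexQuotient_of_cellTwist
    (hCT : exists_casselsTate_pairing (K := ℚ))
    (hsq : Squarefree d) (hd4 : d % 4 ≠ 1) (h7 : ¬ (7 : ℤ) ∣ d)
    (W : WeierstrassCurve ℚ) [W.IsElliptic] [W.IsGloballyMinimal] (C : VariableChange ℚ)
    (hC : C • W = cm7.quadraticTwist (d : ℚ))
    (N : ℕ) [NeZero N] (K : Type) [Field K] [NumberField K]
    (Dt : ModularParametrizationData W N) (H : HeegnerDatum N (NumberField.discr K)) (ι : K →+* ℂ)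
    (P : (W.baseChange K).toAffine.Point)
    (hGZ : gross_zagier N W K) (hKo : kolyvagin N W K)
    (hGZK : rank_eq_analyticRank_of_analyticRank_le_one) (hmod : hasEntireLFunction_rat)
    (hBF : bsdTriple_of_hasCM_of_L_one_ne_zero)
    (hK : IsImaginaryQuadratic K) (hHN : SatisfiesHeegnerHypothesis N K)
    (hHd : SatisfiesHeegnerHypothesis (14 * d.natAbs) K)
    (hP : WeierstrassCurve.Affine.Point.map ι.toRatAlgHom P = heegnerPointComplex Dt H)
    (hr : W.analyticRank = 1)
    (hLt : (W.quadraticTwist (NumberField.discr K : ℚ)).entireLFunction 1 ≠ 0)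
    (Wd : WeierstrassCurve ℚ) [Wd.IsElliptic] [Wd.IsGloballyMinimal] (Cd : VariableChange ℚ)
    (hWd : Cd • W.quadraticTwist (NumberField.discr K : ℚ) = Wd) (k : ℕ) (hk12 : k = 1 ∨ k = 2) :
    Even (padicValRat 2 (cmHeegnerIndexQuotient W K P Dt.c k Wd Cd.u)) := by
  haveI : Fact (Nat.Prime 2) := ⟨Nat.prime_two⟩
  have hd0 : d ≠ 0 := hsq.ne_zero
  obtain ⟨hj, hcm, -⟩ := minimalModel_quadraticTwist_cm7 hd0 W C hC
  ---------------------------------------------------------------- the arithmetic of `D = d_K`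
  obtain ⟨hDneg, -, hDsq, hD7, hcop, hsqD, hdD4, h7D⟩ := heegnerDiscr_arith_of_split hK hsq hd4 h7 hHd
  ---------------------------------------------------------------- non-degeneracy of the datum (the binders)
  obtain ⟨-, -, -, -, hfinpt, hfind, hI0, -, -⟩ := heegnerDatum_nondegenerate_of_facts W N K Dt H ι P hGZ hKo
    hGZK hmod hBF hcm hK hHN hP hr hLt Wd Cd hWd
  haveI := hfinpt
  haveI := hfind
  ---------------------------------------------------------------- the factors
  have hn : (W.baseChange ℝ).numRealComponents = 1 := numRealComponents_eq_one_of_j_eq_neg3375 W hj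
  have hu : |(Cd.u : ℚ)| = 1 := abs_u_eq_one_of_twin_minimal hsq hd4 hsqD hdD4 W C hC Wd Cd hWd
  have hcW := padicValNat_two_tamagawaProduct_of_smul_eq_cm7_quadraticTwist hsq hd4 h7 W C hC
  have hcWd := padicValNat_two_tamagawaProduct_twin hsqD hdD4 h7D W C hC Wd Cd hWd
  have hshaSq : IsSquare Wd.shaOrder := isSquare_card_sha_of_finite_of_casselsTate hCT Wd
  have hsha0 : Wd.shaOrder ≠ 0 := (Nat.card_pos (α := Wd.sha)).ne'
  have hshaEven : Even (padicValNat 2 Wd.shaOrder) := even_padicValNat_two_of_isSquare' hsha0 hshaSq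
  have hodd := odd_card_inertSeven_add_mul_of_heegnerDiscr hd0 hDneg (Int.squarefree_natAbs.mpr hDsq) hD7 hcop
  ---------------------------------------------------------------- non-vanishing
  have htW : 0 < W.torsionOrder := W.torsionOrder_pos_holds
  have htK : 0 < (W.baseChange K).torsionOrder := by
    haveI := KrizLi2019.isElliptic_baseChange' W K; exact (W.baseChange K).torsionOrder_pos_holds
  have hcWpos : 0 < W.tamagawaProduct := W.tamagawaProduct_pos_holds
  have hcWdpos : 0 < Wd.tamagawaProduct := Wd.tamagawaProduct_pos_holds
  have hw : 0 < Units.torsionOrder K := Units.torsionOrder_pos K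
  have hpts : Nat.card Wd.toAffine.Point ≠ 0 := (Nat.card_pos (α := Wd.toAffine.Point)).ne'
  have hk0 : (k : ℚ) ≠ 0 := by rcases hk12 with rfl | rfl <;> norm_num
  rw [even_padicValRat_cmHeegnerIndexQuotient_iff W K P Dt.c k Wd Cd.u (by exact_mod_cast hI0)
    (by exact_mod_cast htW.ne') hk0 (by exact_mod_cast htK.ne') (Int.cast_ne_zero.mpr Dt.maninConstant_ne_zero_holds)
    (by exact_mod_cast hw.ne') (by exact_mod_cast hpts) (by rw [hn]; norm_num) (by exact_mod_cast hsha0)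
    (by exact_mod_cast hcWdpos.ne') (by rw [hu]; norm_num) (by exact_mod_cast hcWpos.ne')]
  ---------------------------------------------------------------- `ord₂ t = 3 − (ord₂ #Ш(Wd) + ord₂ c(Wd) + ord₂ c_W)`
  rw [hn, hu, Nat.cast_one, one_mul, mul_one,
    show (8 : ℚ) / ((Wd.shaOrder : ℚ) * (Wd.tamagawaProduct : ℚ) * (W.tamagawaProduct : ℚ)) =
      (((2 ^ 3 : ℕ) : ℕ) : ℚ) / ((Wd.shaOrder * Wd.tamagawaProduct * W.tamagawaProduct : ℕ) : ℚ) by push_cast; ring,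
    padicValRat.div (by positivity) (by exact_mod_cast mul_ne_zero (mul_ne_zero hsha0 hcWdpos.ne') hcWpos.ne'),
    padicValRat.of_nat, padicValRat.of_nat, padicValNat.prime_pow,
    padicValNat.mul (mul_ne_zero hsha0 hcWdpos.ne') hcWpos.ne', padicValNat.mul hsha0 hcWdpos.ne', hcW, hcWd]
  obtain ⟨m, hm⟩ := hshaEven
  obtain ⟨r, hr⟩ := hodd
  rw [hm, Int.even_iff]
  push_cast
  omega

/-- **P1 on the cell, Heegner hypothesis at the conductor** (`hHd` of the main theorem replaced by the Heegner
hypothesis for `N_W`; §2). [cite: Kramer1981, Thm. 1] [cite: Gross1984, §3] -/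
theorem even_padicValRat_cmHeegnerIndexQuotient_of_cellTwist_of_conductorNorm
    (hCT : exists_casselsTate_pairing (K := ℚ))
    (hsq : Squarefree d) (hd4 : d % 4 ≠ 1) (h7 : ¬ (7 : ℤ) ∣ d)
    (W : WeierstrassCurve ℚ) [W.IsElliptic] [W.IsGloballyMinimal] (C : VariableChange ℚ)
    (hC : C • W = cm7.quadraticTwist (d : ℚ))
    (N : ℕ) [NeZero N] (K : Type) [Field K] [NumberField K]
    (Dt : ModularParametrizationData W N) (H : HeegnerDatum N (NumberField.discr K)) (ι : K →+* ℂ)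
    (P : (W.baseChange K).toAffine.Point)
    (hGZ : gross_zagier N W K) (hKo : kolyvagin N W K)
    (hGZK : rank_eq_analyticRank_of_analyticRank_le_one) (hmod : hasEntireLFunction_rat)
    (hBF : bsdTriple_of_hasCM_of_L_one_ne_zero)
    (hK : IsImaginaryQuadratic K) (hHN : SatisfiesHeegnerHypothesis N K)
    (hHW : SatisfiesHeegnerHypothesis (W.conductorNorm ℤ) K)
    (hP : WeierstrassCurve.Affine.Point.map ι.toRatAlgHom P = heegnerPointComplex Dt H)
    (hr : W.analyticRank = 1)
    (hLt : (W.quadraticTwist (NumberField.discr K : ℚ)).entireLFunction 1 ≠ 0)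
    (Wd : WeierstrassCurve ℚ) [Wd.IsElliptic] [Wd.IsGloballyMinimal] (Cd : VariableChange ℚ)
    (hWd : Cd • W.quadraticTwist (NumberField.discr K : ℚ) = Wd) (k : ℕ) (hk12 : k = 1 ∨ k = 2) :
    Even (padicValRat 2 (cmHeegnerIndexQuotient W K P Dt.c k Wd Cd.u)) :=
  even_padicValRat_cmHeegnerIndexQuotient_of_cellTwist hCT hsq hd4 h7 W C hC N K Dt H ι P hGZ hKo hGZK hmod hBF
    hK hHN (satisfiesHeegnerHypothesis_cellLevel_of_conductorNorm hsq hd4 W C hC hHW) hP hr hLt Wd Cd hWd k hk12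

/-- **P1 on the cell in the EXACT data of the halves, granted Carayol** (`IsNewformOf.level_eq_conductorNorm`, named
fact, binder `hCar`): the stubs' level `N` is `N_W`, so P1 holds for every admissible datum of a globally minimal
`49a1^{(d)}`, `d ≢ 1 (mod 4)`, `7 ∤ d`. [cite: DiamondShurman2005, Thm. 8.8.1] [cite: Kramer1981, Thm. 1] -/
theorem even_padicValRat_cmHeegnerIndexQuotient_of_cellTwist_of_carayol
    (hCT : exists_casselsTate_pairing (K := ℚ))
    (hsq : Squarefree d) (hd4 : d % 4 ≠ 1) (h7 : ¬ (7 : ℤ) ∣ d)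
    (W : WeierstrassCurve ℚ) [W.IsElliptic] [W.IsGloballyMinimal] (C : VariableChange ℚ)
    (hC : C • W = cm7.quadraticTwist (d : ℚ))
    (N : ℕ) [NeZero N] (hCar : IsNewformOf.level_eq_conductorNorm (N := N))
    (K : Type) [Field K] [NumberField K]
    (Dt : ModularParametrizationData W N) (H : HeegnerDatum N (NumberField.discr K)) (ι : K →+* ℂ)
    (P : (W.baseChange K).toAffine.Point)
    (hGZ : gross_zagier N W K) (hKo : kolyvagin N W K)
    (hGZK : rank_eq_analyticRank_of_analyticRank_le_one) (hmod : hasEntireLFunction_rat)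
    (hBF : bsdTriple_of_hasCM_of_L_one_ne_zero)
    (hK : IsImaginaryQuadratic K) (hHN : SatisfiesHeegnerHypothesis N K)
    (hP : WeierstrassCurve.Affine.Point.map ι.toRatAlgHom P = heegnerPointComplex Dt H)
    (hr : W.analyticRank = 1)
    (hLt : (W.quadraticTwist (NumberField.discr K : ℚ)).entireLFunction 1 ≠ 0)
    (Wd : WeierstrassCurve ℚ) [Wd.IsElliptic] [Wd.IsGloballyMinimal] (Cd : VariableChange ℚ)
    (hWd : Cd • W.quadraticTwist (NumberField.discr K : ℚ) = Wd) (k : ℕ) (hk12 : k = 1 ∨ k = 2) :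
    Even (padicValRat 2 (cmHeegnerIndexQuotient W K P Dt.c k Wd Cd.u)) :=
  even_padicValRat_cmHeegnerIndexQuotient_of_cellTwist hCT hsq hd4 h7 W C hC N K Dt H ι P hGZ hKo hGZK hmod hBF
    hK hHN (satisfiesHeegnerHypothesis_cellLevel_of_level_eq hsq hd4 W C hC (Dt.level_eq_conductorNorm_holds hCar) hHN)
    hP hr hLt Wd Cd hWd k hk12

end ParityLaw

end Summit.BirchSwinnertonDyer.BirchSwinnertonDyer.Theorems.GoldfeldGoodTwists

end
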